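import Literature.AlgebraicTopology.SingularHomology.SteenrodSquares
import Literature.AlgebraicTopology.SingularHomology.RelativeCochainsMaps
import HarnessLib

/-!
# Steenrod squares in relative cohomology and the coboundary of a pair

N. E. Steenrod, *Products of cocycles and extensions of mappings*, Ann. of Math. 48 (1947),
§§6–7: the squares `[u] ↦ [u ⌣ᵢ u]` are defined on relative cohomology as well (the `⌣ᵢ` of a
cochain vanishing on `A` with any cochain vanishes on `A`), are natural for maps of pairs, and
COMMUTE WITH THE COBOUNDARY `δ : Hᵖ(A) → Hᵖ⁺¹(X, A)` of the pair: `Sqᵢ δ = δ Sqᵢ₋₁` in the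
lower indexing, i.e. `Sqᵏ δ = δ Sqᵏ` (Mosher–Tangora, *Cohomology Operations* (1968), Ch. 2;
Hatcher, *Algebraic Topology* (2002), §4.L, property (5) with stability). This commutation is the
cochain identity behind the stability of the Steenrod squares under suspension.

For the tree's singular cohomology, the cup-`i` products of `CupIProducts.lean`, the squares of
`SteenrodSquares.lean` and the relative cochains `C^•(X, A; R)` of `RelativeCochains.lean`
(coefficient ring `R` of characteristic two) this file DEFINES the relative squares and PROVES:

* `cochainCupI_mem_relCochains_left/right`: `⌣ᵢ` preserves the cochains vanishing on `A`;
* `relSteenrodSqLower X p A n i : Hᵖ(X, A; R) →+ Hⁿ(X, A; R)`, `[z] ↦ [z ⌣ᵢ z]` (lower indexing,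
  output degree explicit), well defined (`π_relLowerSqCycles_eq_of_π_eq`, the change of
  representative cochain `sqChangeWitness` being relative) and additive (`π_relLowerSqCycles_add`),
  computed on representatives by `relSteenrodSqLower_π`;
* `toAbsolute_relSteenrodSqLower`: compatibility with `Hᵖ(X, A) → Hᵖ(X)`;
* `relSteenrodSqLower_map`: naturality under maps of pairs (`RelativeCochainsMaps.lean`);
* **`relSteenrodSqLower_δ`**: for `x ∈ Hᵖ(A; R)`,
  `Sq_{i+1}(δx) = δ(Sqᵢ x)` in `Hⁿ⁺¹(X, A; R)` — with `ã` the extension by zero of a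
  representative `a`: `δ(Sqᵢ x) = [δ(ã ⌣ᵢ ã)]`, `Sq_{i+1}(δx) = [δã ⌣ᵢ₊₁ δã]`, and the coboundary
  formula gives `δã ⌣ᵢ₊₁ δã + δ(ã ⌣ᵢ ã) = δ(ã ⌣ᵢ₊₁ δã)` with `ã ⌣ᵢ₊₁ δã` relative.

Everything is proved; no named facts. The explicit-degree (`n`, `i`) indexing is the one in which
both sides of the commutation live in the same type `Hⁿ⁺¹(X, A)`; in the upper indexing
(`Sqᵏ = Sq_{p-k} : Hᵖ → Hᵖ⁺ᵏ`) it reads `Sqᵏ δ = δ Sqᵏ`. Deliberately NOT here: excision, the suspension isomorphism itself.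

## References

* N. E. Steenrod, *Products of cocycles and extensions of mappings*, Ann. of Math. (2) 48
  (1947), 290–320, §§6–7. [Steenrod1947]
* A. Hatcher, *Algebraic Topology*, CUP 2002, §3.1 pp. 199–200 (relative cochains, `δ`), §4.L.
  [Hatcher2002]
-/

noncomputable section

open CategoryTheory

universe u v w

namespace Literature.AlgebraicTopology.SingularHomology

variable {R : Type v} [CommRing R]
variable {X Y : Type u} [TopologicalSpace X] [TopologicalSpace Y]
variable {p q n m : ℕ}

open CategoryTheory singularCochainComplex relCochainComplex

/-! ### Generic homological lemmas -/

/-- Transport of an existential over the previous degree of `m + 1` in an `ℕ`-indexed cochain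
complex (`(ComplexShape.up ℕ).prev (m + 1) = m`, propositionally). [folklore] -/
lemma cochainComplex_exists_X_prev_succ_iff (K : CochainComplex (ModuleCat.{w} R) ℕ) (m : ℕ)
    (P : K.X (m + 1) → Prop) :
    (∃ w : K.X ((ComplexShape.up ℕ).prev (m + 1)), P (K.d _ (m + 1) w)) ↔
      ∃ w : K.X m, P (K.d m (m + 1) w) := by
  have key : ∀ k : ℕ, k = m →
      ((∃ w : K.X k, P (K.d k (m + 1) w)) ↔ ∃ w : K.X m, P (K.d m (m + 1) w)) := by
    rintro k rfl; exact Iff.rfl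
  exact key _ (CochainComplex.prev_nat_succ m)

/-- In degree `0` an `ℕ`-indexed cochain complex has no coboundaries. [folklore] -/
lemma cochainComplex_d_prev_zero_apply (K : CochainComplex (ModuleCat.{w} R) ℕ)
    (w : K.X ((ComplexShape.up ℕ).prev 0)) : K.d _ 0 w = 0 := by
  rw [K.shape _ _ (by simp)]; rfl

/-- Two cycles whose difference — in characteristic two, sum — is a boundary have the same
homology class. [folklore] -/
lemma homologyπ_eq_of_exists_d_eq_add [CharP R 2] {ι : Type*}
    {c : ComplexShape ι} (K : HomologicalComplex (ModuleCat.{w} R) c) {i : ι}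
    (z₁ z₂ : K.cycles i)
    (h : ∃ w : K.X (c.prev i), K.d _ i w = K.iCycles i z₁ + K.iCycles i z₂) :
    K.homologyπ i z₁ = K.homologyπ i z₂ := by
  obtain ⟨w, hw⟩ := h
  have hz : z₁ = z₂ + K.toCycles _ i w := by
    apply (ModuleCat.mono_iff_injective (K.iCycles i)).1 inferInstance
    rw [map_add, ← ModuleCat.comp_apply, HomologicalComplex.toCycles_i, hw, add_comm, add_assoc,
      add_self_of_charTwo (R := R), add_zero]
  rw [hz, map_add, ← ModuleCat.comp_apply, HomologicalComplex.toCycles_comp_homologyπ]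
  simp

/-- The class of a cocycle `u ∈ Zⁿ(X; M)` in the tree's notation `π u` is the class
`homologyCls` of its cochain. [folklore] -/
lemma singularCohomology.π_eq_homologyCls {M : Type v} [AddCommGroup M] [Module R M] {n : ℕ}
    (u : cocycles R M X n)
    (hu : (singularCochainComplex R M X).d n ((ComplexShape.up ℕ).next n) (iCocycles R M X n u) = 0) :
    singularCohomology.π R M X n u = homologyCls (iCocycles R M X n u) hu := by
  rw [homologyCls_eq_homologyπ_cyclesMk _ hu (n + 1) (by simp) (d_iCocycles _ u)]
  change _ = singularCohomology.π R M X n _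
  congr 1
  exact cocycles_ext (iCocycles_mk _ _).symm

/-! ### Cup-`i` products of relative cochains -/

namespace SingularSimplex

/-- Restriction along a vertex map does not enlarge the image of a simplex. [folklore] -/
lemma range_vmap_subset {k : ℕ} (g : Fin (k + 1) → Fin (n + 1)) (σ : SingularSimplex X n) :
    (σ.vmap g).range ⊆ σ.range := by
  rintro _ ⟨t, rfl⟩
  rw [range, toContinuousMap_vmap]
  exact ⟨_, rfl⟩

/-- Deleted faces do not enlarge the image of a simplex. [folklore] -/
lemma range_dface_subset (k : ℕ) (A : Finset (Fin (n + 1))) (σ : SingularSimplex X n) :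
    (σ.dface k A).range ⊆ σ.range :=
  range_vmap_subset _ σ

end SingularSimplex

/-- **Cup-`i` products preserve relative cochains (left factor)**: if `φ` vanishes on the
simplices in `A` then so does `φ ⌣ᵢ ψ` (every deleted face of a simplex in `A` lies in `A`;
Hatcher 2002, §3.2 p. 209 for `⌣`). [cite: Hatcher2002, §3.2 p. 209] -/
lemma cochainCupI_mem_relCochains_left {A : Set X} {i : ℕ} {φ : SingularSimplex X p → R}
    (hφ : φ ∈ relCochains R R A p) (ψ : SingularSimplex X q → R) :
    cochainCupI n i φ ψ ∈ relCochains R R A n := by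
  intro σ hσ
  rw [cochainCupI_apply]
  exact Finset.sum_eq_zero fun U _ => by
    rw [hφ _ ((SingularSimplex.range_dface_subset _ _ σ).trans hσ), zero_mul]

/-- **Cup-`i` products preserve relative cochains (right factor)**. [cite: Hatcher2002, §3.2 p. 209] -/
lemma cochainCupI_mem_relCochains_right {A : Set X} {i : ℕ} (φ : SingularSimplex X p → R)
    {ψ : SingularSimplex X q → R} (hψ : ψ ∈ relCochains R R A q) :
    cochainCupI n i φ ψ ∈ relCochains R R A n := by
  intro σ hσ
  rw [cochainCupI_apply]
  exact Finset.sum_eq_zero fun U _ => by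
    rw [hψ _ ((SingularSimplex.range_dface_subset _ _ σ).trans hσ), mul_zero]

/-! ### Relative cocycles as functions -/

section RelCoFn

variable {A : Set X}

/-- The cochain of a relative cocycle `z ∈ Zᵖ(X, A; R)`, as a function. [folklore] -/
abbrev relCoFn (z : (relCochainComplex R R A).cycles p) : SingularSimplex X p → R :=
  val ((relCochainComplex R R A).iCycles p z)

/-- The cochain of a relative cocycle is a relative cochain. [folklore] -/
lemma relCoFn_mem (z : (relCochainComplex R R A).cycles p) : relCoFn z ∈ relCochains R R A p :=
  val_mem _

/-- The cochain of a relative cocycle is a cocycle: `δ(relCoFn z) = 0`. [folklore] -/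
@[simp] lemma coboundary_relCoFn (z : (relCochainComplex R R A).cycles p) :
    coboundary p (relCoFn z) = 0 := by
  have h := val_d ((relCochainComplex R R A).iCycles p z)
  rw [← ModuleCat.comp_apply, HomologicalComplex.iCycles_d] at h
  exact h.symm

/-- `relCoFn (z + z') = relCoFn z + relCoFn z'`. [folklore] -/
@[simp] lemma relCoFn_add (z z' : (relCochainComplex R R A).cycles p) :
    relCoFn (z + z') = relCoFn z + relCoFn z' := by
  unfold relCoFn; rw [map_add]; rfl

/-- `relCoFn 0 = 0`. [folklore] -/
@[simp] lemma relCoFn_zero : relCoFn (0 : (relCochainComplex R R A).cycles p) = 0 := by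
  unfold relCoFn; rw [map_zero]; rfl

/-- Relative cocycles are determined by their cochains. [folklore] -/
lemma relCoFn_injective :
    Function.Injective (relCoFn : (relCochainComplex R R A).cycles p → SingularSimplex X p → R) :=
  fun _ _ h => (ModuleCat.mono_iff_injective ((relCochainComplex R R A).iCycles p)).1
    inferInstance (relCochainComplex.val_injective h)

/-- A relative cochain with zero coboundary is killed by the relative differential. [folklore] -/
lemma d_mk_eq_zero (φ : SingularSimplex X p → R) (hφ : φ ∈ relCochains R R A p)
    (hd : coboundary p φ = 0) : (relCochainComplex R R A).d p (p + 1) (mk φ hφ) = 0 :=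
  relCochainComplex.val_injective (by rw [val_d, val_mk, val_zero]; exact hd)

/-- Build a relative cocycle from a relative cochain with zero coboundary. [folklore] -/
def relCyclesMk (φ : SingularSimplex X p → R) (hφ : φ ∈ relCochains R R A p)
    (hd : coboundary p φ = 0) : (relCochainComplex R R A).cycles p :=
  (relCochainComplex R R A).cyclesMk (mk φ hφ) (p + 1) (by simp) (d_mk_eq_zero φ hφ hd)

/-- The cochain of a relative cocycle built with `cyclesMk`. [folklore] -/
@[simp] lemma relCoFn_cyclesMk_mk (φ : SingularSimplex X p → R) (hφ : φ ∈ relCochains R R A p)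
    (j : ℕ) (hj : (ComplexShape.up ℕ).next p = j) (hx : (relCochainComplex R R A).d p j (mk φ hφ) = 0) :
    relCoFn ((relCochainComplex R R A).cyclesMk (mk φ hφ) j hj hx) = φ :=
  congrArg relCochainComplex.val ((relCochainComplex R R A).i_cyclesMk (mk φ hφ) j hj hx)

/-- `relCoFn (relCyclesMk φ _ _) = φ`. [folklore] -/
@[simp] lemma relCoFn_relCyclesMk (φ : SingularSimplex X p → R) (hφ : φ ∈ relCochains R R A p)
    (hd : coboundary p φ = 0) : relCoFn (relCyclesMk φ hφ hd) = φ :=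
  congrArg relCochainComplex.val
    ((relCochainComplex R R A).i_cyclesMk (mk φ hφ) (p + 1) (by simp) (d_mk_eq_zero φ hφ hd))

end RelCoFn

/-! ### The relative squares -/

section CharTwo

variable [CharP R 2]

/-- **Steenrod's square on relative cocycles**: `z ↦ z ⌣ᵢ z ∈ Zⁿ(X, A; R)` for
`z ∈ Zᵖ(X, A; R)` (the product of relative cochains is relative). [cite: Steenrod1947, §6] -/
def relLowerSqCycles {A : Set X} (n i : ℕ) (z : (relCochainComplex R R A).cycles p) :
    (relCochainComplex R R A).cycles n :=
  relCyclesMk (cochainCupI n i (relCoFn z) (relCoFn z))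
    (cochainCupI_mem_relCochains_left (relCoFn_mem z) _)
    (coboundary_cochainCupI_self_eq_zero i (coboundary_relCoFn z))

/-- The cochain of `relLowerSqCycles n i z` is `relCoFn z ⌣ᵢ relCoFn z`. [folklore] -/
@[simp] lemma relCoFn_relLowerSqCycles {A : Set X} (n i : ℕ) (z : (relCochainComplex R R A).cycles p) :
    relCoFn (relLowerSqCycles n i z) = cochainCupI n i (relCoFn z) (relCoFn z) :=
  relCoFn_relCyclesMk _ _ _

/-- `relLowerSqCycles n i 0 = 0`. [folklore] -/
@[simp] lemma relLowerSqCycles_zero {A : Set X} (n i : ℕ) :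
    relLowerSqCycles n i (0 : (relCochainComplex R R A).cycles p) = 0 :=
  relCoFn_injective (by
    rw [relCoFn_relLowerSqCycles, relCoFn_zero, relCoFn_zero]
    refine funext fun σ ↦ ?_
    rw [cochainCupI_apply]
    exact Finset.sum_eq_zero fun _ _ => by simp)

/-- The explicit cochain `w = a ⌣ᵢ₊₁ δc + c ⌣ᵢ δc + c ⌣ᵢ₋₁ c` of the change of representative
(`SteenrodSquares.lean`, `exists_d_eq_cochainCupI_add_coboundary_self`). [cite: Steenrod1947, §6] -/
def sqChangeWitness (n i : ℕ) (a : SingularSimplex X (m + 1) → R) (c : SingularSimplex X m → R) :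
    SingularSimplex X n → R :=
  cochainCupI n (i + 1) a (coboundary m c) + cochainCupI n i c (coboundary m c) +
    match i with
    | 0 => 0
    | j + 1 => cochainCupI n j c c

omit [CharP R 2] in
/-- The change-of-representative cochain is relative if `a` and `c` are. [folklore] -/
lemma sqChangeWitness_mem {A : Set X} (n i : ℕ) {a : SingularSimplex X (m + 1) → R}
    (ha : a ∈ relCochains R R A (m + 1)) {c : SingularSimplex X m → R}
    (hc : c ∈ relCochains R R A m) : sqChangeWitness n i a c ∈ relCochains R R A n := by
  unfold sqChangeWitness
  refine (relCochains R R A n).add_mem ((relCochains R R A n).add_mem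
    (cochainCupI_mem_relCochains_left ha _) (cochainCupI_mem_relCochains_left hc _)) ?_
  cases i with
  | zero => exact (relCochains R R A n).zero_mem
  | succ j => exact cochainCupI_mem_relCochains_left hc _

/-- **The change of representative, explicit form**:
`δw = a ⌣ᵢ a + (a + δc) ⌣ᵢ (a + δc)` for `δa = 0` and `w = a ⌣ᵢ₊₁ δc + c ⌣ᵢ δc + c ⌣ᵢ₋₁ c`
(Steenrod 1947, §6). [cite: Steenrod1947, §6] -/
theorem coboundary_sqChangeWitness (n i : ℕ) {a : SingularSimplex X (m + 1) → R}
    (ha : coboundary (m + 1) a = 0) (c : SingularSimplex X m → R) :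
    coboundary n (sqChangeWitness n i a c) =
      cochainCupI (n + 1) i a a +
        cochainCupI (n + 1) i (a + coboundary m c) (a + coboundary m c) := by
  have hexp : cochainCupI (n + 1) i a a +
      cochainCupI (n + 1) i (a + coboundary m c) (a + coboundary m c) =
      (cochainCupI (n + 1) i a (coboundary m c) + cochainCupI (n + 1) i (coboundary m c) a) +
        cochainCupI (n + 1) i (coboundary m c) (coboundary m c) := by
    rw [map_add (cochainCupI (n + 1) i) a (coboundary m c), LinearMap.add_apply,
      map_add (cochainCupI (n + 1) i a), map_add (cochainCupI (n + 1) i (coboundary m c))]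
    linear_combination add_self_cochain (cochainCupI (n + 1) i a a)
  rw [hexp]
  unfold sqChangeWitness
  cases i with
  | zero =>
    rw [add_zero, coboundary_add, coboundary_cochainCupI_succ, coboundary_cochainCupI_zero, ha,
      coboundary_coboundary]
    simp only [map_zero, LinearMap.zero_apply, zero_add, add_zero]
  | succ j =>
    dsimp only
    rw [coboundary_add, coboundary_add, coboundary_cochainCupI_succ, coboundary_cochainCupI_succ,
      coboundary_cochainCupI_self, ha, coboundary_coboundary]
    simp only [map_zero, LinearMap.zero_apply, zero_add, add_zero]
    linear_combination add_self_cochain (cochainCupI (n + 1) j c (coboundary m c)) +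
      add_self_cochain (cochainCupI (n + 1) j (coboundary m c) c)

/-- **The relative square passes to cohomology**: cohomologous relative cocycles have
cohomologous squares (the change-of-representative cochain is relative). [cite: Steenrod1947, §6] -/
lemma π_relLowerSqCycles_eq_of_π_eq {A : Set X} (n i : ℕ) {z z' : (relCochainComplex R R A).cycles p}
    (h : relSingularCohomology.π R R X A p z = relSingularCohomology.π R R X A p z') :
    relSingularCohomology.π R R X A n (relLowerSqCycles n i z) =
      relSingularCohomology.π R R X A n (relLowerSqCycles n i z') := by
  have h0 : relSingularCohomology.π R R X A p (z + z') = 0 := by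
    rw [map_add, h, add_self_of_charTwo (R := R)]
  obtain ⟨w, hw⟩ := (relSingularCohomology.π_eq_zero_iff (z + z')).1 h0
  cases p with
  | zero =>
    rw [cochainComplex_d_prev_zero_apply] at hw
    have hzz' : z + z' = 0 :=
      (ModuleCat.mono_iff_injective ((relCochainComplex R R A).iCycles 0)).1 inferInstance
        (by rw [← hw, map_zero])
    have : z = z' := by
      calc z = z + (z' + z') := by rw [add_self_of_charTwo (R := R), add_zero]
        _ = z' := by rw [← add_assoc, hzz', zero_add]
    rw [this]
  | succ m =>
    obtain ⟨c, hc⟩ := (cochainComplex_exists_X_prev_succ_iff (relCochainComplex R R A) m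
      (fun t => t = (relCochainComplex R R A).iCycles (m + 1) (z + z'))).1 ⟨w, hw⟩
    have hc' : relCoFn z' = relCoFn z + coboundary m (val c) := by
      have e := congrArg relCochainComplex.val hc
      rw [val_d] at e
      change coboundary m (val c) = relCoFn (z + z') at e
      rw [relCoFn_add] at e
      rw [e, ← add_assoc, add_self_cochain, zero_add]
    refine homologyπ_eq_of_exists_d_eq_add (relCochainComplex R R A) _ _ ?_
    cases n with
    | zero =>
      refine ⟨0, ?_⟩
      rw [map_zero]
      apply relCochainComplex.val_injective
      change (0 : SingularSimplex X 0 → R) = relCoFn (relLowerSqCycles 0 i z) +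
        relCoFn (relLowerSqCycles 0 i z')
      rw [relCoFn_relLowerSqCycles, relCoFn_relLowerSqCycles, cochainCupI_self_deg_zero,
        cochainCupI_self_deg_zero, add_zero]
    | succ n' =>
      refine (cochainComplex_exists_X_prev_succ_iff (relCochainComplex R R A) n' (fun t => t = _)).2 ?_
      refine ⟨mk (sqChangeWitness n' i (relCoFn z) (val c))
        (sqChangeWitness_mem n' i (relCoFn_mem z) (val_mem c)), ?_⟩
      apply relCochainComplex.val_injective
      rw [val_d, val_mk]
      change coboundary n' (sqChangeWitness n' i (relCoFn z) (val c)) =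
        relCoFn (relLowerSqCycles (n' + 1) i z) + relCoFn (relLowerSqCycles (n' + 1) i z')
      rw [coboundary_sqChangeWitness n' i (coboundary_relCoFn z), relCoFn_relLowerSqCycles,
        relCoFn_relLowerSqCycles, hc']

/-- Additivity of the relative square on cocycles: the cross terms `u ⌣ᵢ v + v ⌣ᵢ u = δ(u ⌣ᵢ₊₁ v)`
are a RELATIVE coboundary. [cite: Steenrod1947, Thm. 5.1] -/
lemma π_relLowerSqCycles_add {A : Set X} (n i : ℕ) (z z' : (relCochainComplex R R A).cycles p) :
    relSingularCohomology.π R R X A n (relLowerSqCycles n i (z + z')) =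
      relSingularCohomology.π R R X A n (relLowerSqCycles n i z) +
        relSingularCohomology.π R R X A n (relLowerSqCycles n i z') := by
  rw [← map_add]
  refine homologyπ_eq_of_exists_d_eq_add (relCochainComplex R R A) _ _ ?_
  have hexp : relCoFn (relLowerSqCycles n i (z + z')) +
      relCoFn (relLowerSqCycles n i z + relLowerSqCycles n i z') =
      cochainCupI n i (relCoFn z) (relCoFn z') + cochainCupI n i (relCoFn z') (relCoFn z) := by
    rw [relCoFn_add, relCoFn_relLowerSqCycles, relCoFn_relLowerSqCycles, relCoFn_relLowerSqCycles,
      relCoFn_add, map_add (cochainCupI n i) (relCoFn z) (relCoFn z'), LinearMap.add_apply,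
      map_add (cochainCupI n i (relCoFn z)), map_add (cochainCupI n i (relCoFn z'))]
    linear_combination add_self_cochain (cochainCupI n i (relCoFn z) (relCoFn z)) +
      add_self_cochain (cochainCupI n i (relCoFn z') (relCoFn z'))
  cases n with
  | zero =>
    refine ⟨0, ?_⟩
    rw [map_zero]
    apply relCochainComplex.val_injective
    change (0 : SingularSimplex X 0 → R) = relCoFn _ + relCoFn _
    rw [hexp, cochainCupI_symm_deg_zero]
  | succ n' =>
    refine (cochainComplex_exists_X_prev_succ_iff (relCochainComplex R R A) n' (fun t => t = _)).2 ?_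
    refine ⟨mk (cochainCupI n' (i + 1) (relCoFn z) (relCoFn z'))
      (cochainCupI_mem_relCochains_left (relCoFn_mem z) _), ?_⟩
    apply relCochainComplex.val_injective
    rw [val_d, val_mk]
    change coboundary n' (cochainCupI n' (i + 1) (relCoFn z) (relCoFn z')) = relCoFn _ + relCoFn _
    rw [hexp, coboundary_cochainCupI_succ, coboundary_relCoFn, coboundary_relCoFn, map_zero,
      LinearMap.zero_apply, map_zero, zero_add, zero_add]

omit [CharP R 2] in
/-- Every relative cohomology class is the class of a relative cocycle. [folklore] -/
lemma relSingularCohomology.π_surjective (A : Set X) (n : ℕ) :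
    Function.Surjective (relSingularCohomology.π R R X A n) :=
  (ModuleCat.epi_iff_surjective ((relCochainComplex R R A).homologyπ n)).1 inferInstance

variable (p) in
/-- `Sqᵢ` on relative classes (via a chosen representative). [folklore] -/
def relLowerSqClass (A : Set X) (n i : ℕ) (x : relSingularCohomology R R X A p) :
    relSingularCohomology R R X A n :=
  relSingularCohomology.π R R X A n
    (relLowerSqCycles n i (Classical.choose (relSingularCohomology.π_surjective A p x)))

/-- `relLowerSqClass n i [z] = [z ⌣ᵢ z]`. [cite: Steenrod1947, §6] -/
lemma relLowerSqClass_π {A : Set X} (n i : ℕ) (z : (relCochainComplex R R A).cycles p) :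
    relLowerSqClass p A n i (relSingularCohomology.π R R X A p z) =
      relSingularCohomology.π R R X A n (relLowerSqCycles n i z) :=
  π_relLowerSqCycles_eq_of_π_eq n i
    (Classical.choose_spec (relSingularCohomology.π_surjective A p
      (relSingularCohomology.π R R X A p z)))

variable (X p) in
/-- **The relative Steenrod square** `Sqᵢ : Hᵖ(X, A; R) → Hⁿ(X, A; R)`, `[z] ↦ [z ⌣ᵢ z]`,
lower indexing with explicit output degree (zero unless `p + p = n + i`), `R` of characteristic
two (Steenrod 1947, §6; the squares "are defined equally well for relative cohomology"). An
additive map, compatible with `Hᵖ(X, A) → Hᵖ(X)` (`toAbsolute_relSteenrodSqLower`) and with the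
coboundary of the pair (`relSteenrodSqLower_δ`). [cite: Steenrod1947, §6] -/
def relSteenrodSqLower (A : Set X) (n i : ℕ) :
    relSingularCohomology R R X A p →+ relSingularCohomology R R X A n where
  toFun := relLowerSqClass p A n i
  map_zero' := by
    rw [← map_zero (ConcreteCategory.hom (relSingularCohomology.π R R X A p)), relLowerSqClass_π,
      relLowerSqCycles_zero, map_zero]
  map_add' x y := by
    obtain ⟨z, rfl⟩ := relSingularCohomology.π_surjective A p x
    obtain ⟨z', rfl⟩ := relSingularCohomology.π_surjective A p y
    rw [← map_add, relLowerSqClass_π, relLowerSqClass_π, relLowerSqClass_π, π_relLowerSqCycles_add]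

/-- **The relative square on representatives**: `Sqᵢ[z] = [z ⌣ᵢ z]`. [cite: Steenrod1947, §6] -/
@[simp] lemma relSteenrodSqLower_π {A : Set X} (n i : ℕ) (z : (relCochainComplex R R A).cycles p) :
    relSteenrodSqLower X p A n i (relSingularCohomology.π R R X A p z) =
      relSingularCohomology.π R R X A n (relLowerSqCycles n i z) :=
  relLowerSqClass_π n i z

/-- **Compatibility with `Hᵖ(X, A) → Hᵖ(X)`**: `j^* Sqᵢ = Sqᵢ j^*` (naturality of the squares
under the map of pairs `(X, ∅) → (X, A)`; Steenrod 1947, §7). [cite: Steenrod1947, §7] -/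
theorem toAbsolute_relSteenrodSqLower {A : Set X} (n i : ℕ) (x : relSingularCohomology R R X A p) :
    relSingularCohomology.toAbsolute R R X A n (relSteenrodSqLower X p A n i x) =
      steenrodSqLower X p n i (relSingularCohomology.toAbsolute R R X A p x) := by
  obtain ⟨z, rfl⟩ := relSingularCohomology.π_surjective A p x
  rw [relSteenrodSqLower_π]
  change ((relCochainComplex R R A).homologyπ n ≫ HomologicalComplex.homologyMap (ι R R A) n) _ =
    steenrodSqLower X p n i (((relCochainComplex R R A).homologyπ p ≫
      HomologicalComplex.homologyMap (ι R R A) p) z)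
  rw [HomologicalComplex.homologyπ_naturality, HomologicalComplex.homologyπ_naturality,
    ModuleCat.comp_apply, ModuleCat.comp_apply]
  change singularCohomology.π R R X n _ = steenrodSqLower X p n i (singularCohomology.π R R X p _)
  rw [steenrodSqLower_π]
  congr 1
  refine coFn_injective ?_
  rw [coFn_lowerSqCocycles]
  change (iCocycles R R X n) (HomologicalComplex.cyclesMap (ι R R A) n _) =
    cochainCupI n i ((iCocycles R R X p) (HomologicalComplex.cyclesMap (ι R R A) p z))
      ((iCocycles R R X p) (HomologicalComplex.cyclesMap (ι R R A) p z))
  rw [← ModuleCat.comp_apply, ← ModuleCat.comp_apply, HomologicalComplex.cyclesMap_i,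
    HomologicalComplex.cyclesMap_i, ModuleCat.comp_apply, ModuleCat.comp_apply, ι_f_apply, ι_f_apply]
  exact relCoFn_relLowerSqCycles n i z

end CharTwo

/-! ### Extension by zero and the coboundary of the pair -/

section Extend

variable {M : Type v} [AddCommGroup M] [Module R M] (A : Set X)

/-- Extension by zero `Cᵖ(A; M) → Cᵖ(X; M)` of cochains of the subspace `A` (Hatcher 2002,
§3.1, p. 199). [cite: Hatcher2002, §3.1 p. 199] -/
def extendByZero (a : SingularSimplex A p → M) : SingularSimplex X p → M :=
  Function.extend (fun τ : SingularSimplex A p ↦ τ.map (subsetIncl A)) a 0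

/-- The extension by zero restricts back to the given cochain. [cite: Hatcher2002, §3.1 p. 199] -/
@[simp] lemma ρ_extendByZero (a : SingularSimplex A p → M) :
    (ρ R M A).f p (extendByZero A a) = a := by
  refine funext fun τ ↦ ?_
  rw [singularCochainComplex.map_apply]
  exact (SingularSimplex.map_injective (n := p) (f := subsetIncl A)
    Subtype.val_injective).extend_apply a 0 τ

variable {A}

/-- The restriction `ρ` is a cochain map: `ρ(δβ) = δ(ρβ)`. [folklore] -/
lemma ρ_d (i j : ℕ) (β : SingularSimplex X i → M) :
    (ρ R M A).f j ((singularCochainComplex R M X).d i j β) =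
      (singularCochainComplex R M A).d i j ((ρ R M A).f i β) := by
  rw [← ModuleCat.comp_apply, ← (ρ R M A).comm, ModuleCat.comp_apply]

/-- **The coboundary of a lift of a cocycle of `A` is a relative cochain.** [cite: Hatcher2002, §3.1 p. 200] -/
lemma d_mem_relCochains_of_ρ_cocycle {i j : ℕ} (β : SingularSimplex X i → M)
    (h : (singularCochainComplex R M A).d i j ((ρ R M A).f i β) = 0) :
    ((singularCochainComplex R M X).d i j β : SingularSimplex X j → M) ∈ relCochains R M A j :=
  mem_relCochains_of_ρ_eq_zero (by rw [ρ_d, h])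

end Extend

/-! ### The Steenrod squares commute with the coboundary of the pair -/

section Delta

variable [CharP R 2] {A : Set X}

/-- **`Sqᵢ` commutes with the connecting homomorphism of the pair `(X, A)`** (Steenrod 1947,
§7, Thm. 7.3-type statement "`Sqᵢ δ = δ Sqᵢ₋₁`"; Mosher–Tangora Ch. 2; in the present explicit
indexing): for `x ∈ Hᵖ(A; R)`,
`Sq_{i+1}(δx) = δ(Sqᵢ x)` in `Hⁿ⁺¹(X, A; R)`, where `δ : Hᵖ(A) → Hᵖ⁺¹(X, A)` on the left and
`δ : Hⁿ(A) → Hⁿ⁺¹(X, A)` on the right (upper indexing: `Sqᵏ δ = δ Sqᵏ`, `k = p - i`). Cochain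
proof: with `ã` the extension by zero of a representative `a`, `δ(Sqᵢ x) = [δ(ã ⌣ᵢ ã)]`,
`Sq_{i+1}(δx) = [δã ⌣ᵢ₊₁ δã]`, and
`δã ⌣ᵢ₊₁ δã + δ(ã ⌣ᵢ ã) = δ(ã ⌣ᵢ₊₁ δã)` with `ã ⌣ᵢ₊₁ δã` relative. [cite: Steenrod1947, §7] -/
theorem relSteenrodSqLower_δ (n i : ℕ) (x : singularCohomology R R A p) :
    relSteenrodSqLower X (p + 1) A (n + 1) (i + 1)
        (relSingularCohomology.δ R R X A p (p + 1) rfl x) =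
      relSingularCohomology.δ R R X A n (n + 1) rfl (steenrodSqLower A p n i x) := by
  induction x using singularCohomology_induction_on with
  | h α =>
  -- representatives
  set a : SingularSimplex A p → R := coFn α with ha_def
  set ae : SingularSimplex X p → R := extendByZero A a with hae
  have hρ : (ρ R R A).f p ae = a := ρ_extendByZero A a
  have ha : coboundary p a = 0 := coboundary_coFn α
  have hda_mem : (coboundary p ae : SingularSimplex X (p + 1) → R) ∈ relCochains R R A (p + 1) :=
    d_mem_relCochains_of_ρ_cocycle ae (by rw [hρ]; exact ha)
  -- the class `x = [a]` and its square `[a ⌣ᵢ a]`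
  have hx : singularCohomology.π R R A p α = homologyCls a
      (by change (singularCochainComplex R R A).d p _ (iCocycles R R A p α) = 0
          exact d_iCocycles _ α) := singularCohomology.π_eq_homologyCls α _
  have hsqd : (singularCochainComplex R R A).d n ((ComplexShape.up ℕ).next n)
      (cochainCupI n i a a) = 0 := by
    rw [← coFn_lowerSqCocycles n i α]; exact d_iCocycles _ _
  have hsq : steenrodSqLower A p n i (singularCohomology.π R R A p α) =
      homologyCls (cochainCupI n i a a) hsqd := by
    rw [steenrodSqLower_π, singularCohomology.π_eq_homologyCls _ (d_iCocycles _ _)]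
    exact homologyCls_congr (coFn_lowerSqCocycles n i α) _ _
  -- lift of `a ⌣ᵢ a`: `ã ⌣ᵢ ã`
  have hρsq : (ρ R R A).f n (cochainCupI n i ae ae) = cochainCupI n i a a := by
    change (singularCochainComplex.map R R (subsetIncl A)).f n (cochainCupI n i ae ae) = _
    rw [cochainCupI_map, ← hρ]
  have hdsq_mem : ((singularCochainComplex R R X).d n (n + 1) (cochainCupI n i ae ae) :
      SingularSimplex X (n + 1) → R) ∈ relCochains R R A (n + 1) := by
    change coboundary n (cochainCupI n i ae ae) ∈ _
    rw [coboundary_cochainCupI_self]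
    exact (relCochains R R A (n + 1)).add_mem (cochainCupI_mem_relCochains_left hda_mem _)
      (cochainCupI_mem_relCochains_right _ hda_mem)
  -- both sides as classes of explicit relative cocycles
  rw [hsq, relSingularCohomology.δ_homologyCls rfl _ _ _ hρsq hdsq_mem
      (relSingularCohomology.d_mk_d_eq_zero _ _ _),
    homologyCls_eq_homologyπ_cyclesMk _ _ (n + 1 + 1) (by simp)
      (relSingularCohomology.d_mk_d_eq_zero _ _ _),
    hx, relSingularCohomology.δ_homologyCls rfl a _ ae hρ hda_mem
      (relSingularCohomology.d_mk_d_eq_zero _ _ _),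
    homologyCls_eq_homologyπ_cyclesMk _ _ (p + 1 + 1) (by simp)
      (relSingularCohomology.d_mk_d_eq_zero _ _ _)]
  change relSteenrodSqLower X (p + 1) A (n + 1) (i + 1) (relSingularCohomology.π R R X A (p + 1) _) =
    relSingularCohomology.π R R X A (n + 1) _
  rw [relSteenrodSqLower_π]
  refine homologyπ_eq_of_exists_d_eq_add (relCochainComplex R R A) _ _ ?_
  refine (cochainComplex_exists_X_prev_succ_iff (relCochainComplex R R A) n (fun t => t = _)).2 ?_
  refine ⟨mk (cochainCupI n (i + 1) ae (coboundary p ae))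
    (cochainCupI_mem_relCochains_right _ hda_mem), ?_⟩
  apply relCochainComplex.val_injective
  rw [val_d, val_mk, val_add]
  change coboundary n (cochainCupI n (i + 1) ae (coboundary p ae)) =
    relCoFn (relLowerSqCycles (n + 1) (i + 1) _) + relCoFn _
  rw [relCoFn_relLowerSqCycles, relCoFn_cyclesMk_mk, relCoFn_cyclesMk_mk]
  change _ = cochainCupI (n + 1) (i + 1) (coboundary p ae) (coboundary p ae) +
    coboundary n (cochainCupI n i ae ae)
  rw [coboundary_cochainCupI_succ, coboundary_coboundary, map_zero, add_zero,
    coboundary_cochainCupI_self]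
  abel

end Delta


/-! ### Naturality of the relative Steenrod squares under maps of pairs -/

section MapsOfPairs

variable [CharP R 2]

omit [CharP R 2] in
/-- `f♯` on relative cocycles: the cochain of `cyclesMap f♯ z` is the pull-back of the cochain of
`z`. [folklore] -/
lemma relCoFn_cyclesMap {A : Set X} {B : Set Y} (f : C(X, Y)) (h : Set.MapsTo f A B) {p : ℕ}
    (z : (relCochainComplex R R B).cycles p) :
    relCoFn (HomologicalComplex.cyclesMap (relCochainComplex.map R R f h) p z) =
      (singularCochainComplex.map R R f).f p (relCoFn z) := by
  unfold relCoFn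
  rw [← ModuleCat.comp_apply, HomologicalComplex.cyclesMap_i, ModuleCat.comp_apply,
    relCochainComplex.val_map_f]

/-- **Naturality of the relative squares**: `f^* ∘ Sqᵢ = Sqᵢ ∘ f^*` for a map of pairs
`f : (X, A) → (Y, B)` (Steenrod 1947, §7; Medina-Mardones 2023, Lemma 12 for the products).
[cite: Steenrod1947, §7] -/
theorem relSteenrodSqLower_map {A : Set X} {B : Set Y} (f : C(X, Y)) (h : Set.MapsTo f A B)
    {p : ℕ} (n i : ℕ) (x : relSingularCohomology R R Y B p) :
    relSingularCohomology.map R R f h n (relSteenrodSqLower Y p B n i x) =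
      relSteenrodSqLower X p A n i (relSingularCohomology.map R R f h p x) := by
  obtain ⟨z, rfl⟩ := relSingularCohomology.π_surjective B p x
  rw [relSteenrodSqLower_π]
  change ((relCochainComplex R R B).homologyπ n ≫
      HomologicalComplex.homologyMap (relCochainComplex.map R R f h) n) _ =
    relSteenrodSqLower X p A n i (((relCochainComplex R R B).homologyπ p ≫
      HomologicalComplex.homologyMap (relCochainComplex.map R R f h) p) z)
  rw [HomologicalComplex.homologyπ_naturality, HomologicalComplex.homologyπ_naturality,
    ModuleCat.comp_apply, ModuleCat.comp_apply]
  change relSingularCohomology.π R R X A n _ =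
    relSteenrodSqLower X p A n i (relSingularCohomology.π R R X A p _)
  rw [relSteenrodSqLower_π]
  congr 1
  refine relCoFn_injective ?_
  rw [relCoFn_cyclesMap, relCoFn_relLowerSqCycles, relCoFn_relLowerSqCycles, relCoFn_cyclesMap,
    cochainCupI_map]

end MapsOfPairs

end Literature.AlgebraicTopology.SingularHomology
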